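import Mathlib
import Summits.KontsevichZagierPeriods.KontsevichZagierPeriods.Theorems.SoloInformedBandSide
import Summits.KontsevichZagierPeriods.KontsevichZagierPeriods.Theorems.SoloInformedSideCases
import HarnessLib

/-!
# Solo-informed (A390-ii): finiteness of the weighted integral over a prepared band

File F4h of the KERNEL LEMMA I programme.  Combining the bundle over the base of a prepared band
(file `SoloInformedBandSide`) with the case analysis over its two sides (file
`SoloInformedSideCases`): if `F ≥ 0` has finite integral over the band `D = bandOver B ξ j` above the
parameter `t`, and `F`, `ρᵢ` carry Lion–Rolin data over `B`, then `F · (1 + Σᵢ |log ρᵢ|)ᵖ` has finite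
integral over `D` above `t` — granted the log-room statement `SoloInformedLogRoomAt k m` one
dimension down (`soloInformed_band_lt_top`).  The four cases `j = 0 / j = last` decide which fibre
endpoints are infinite.
-/

open MeasureTheory Set Real
open scoped ENNReal
open Literature.ModelTheory.ExponentialFields Literature.NumberTheory.Transcendental

namespace Summit.KontsevichZagierPeriods.KontsevichZagierPeriods.Theorems

variable {k m l : ℕ} {B : Set (Fin (k + m) → ℝ)} {ξ : Fin l → (Fin (k + m) → ℝ) → ℝ}
  {j : Fin (l + 1)} {F : (Fin (k + m + 1) → ℝ) → ℝ} {ι : Type} [Fintype ι] {p : ℕ}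
  {σ : ι → (Fin (k + m) → ℝ) → ℝ} {HW H₀ : (Fin (k + m) → ℝ) → ℝ≥0∞}
  {Λ : (Fin (k + m) → ℝ) → ℝ} {CW C₂ c : ℝ}

/-- Over the base of a band whose fibres are the whole line there is no Lion–Rolin centre:
the base is empty and the weighted integral vanishes. -/
theorem soloInformed_band_sides_line (d₀ : SoloInformedLRData B (bandOver B ξ j) F)
    (hj0 : j = 0) (hjl : j = Fin.last l) (t : Fin k → ℝ) :
    ∫⁻ x, B.indicator HW (Fin.append t x) < ∞ := by
  rw [soloInformed_zeroPiece_eq_zero t fun w hw => ?_]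
  · exact ENNReal.zero_lt_top
  · exfalso
    have hlow : bandLower ξ j w = ⊥ := by rw [hj0]; exact bandLower_zero ξ w
    have hupp : bandUpper ξ j w = ⊤ := by rw [hjl]; exact bandUpper_last ξ w
    rcases soloInformed_EIoo_side (d₀.θ_notMem hw) with h | h
    · rw [hlow, le_bot_iff] at h
      exact EReal.coe_ne_bot _ h
    · rw [hupp, top_le_iff] at h
      exact EReal.coe_ne_top _ h

/-- Lower half-line fibres (`j = 0 ≠ last`): every centre lies above, `β = ⊤`. -/
theorem soloInformed_band_sides_lower (ih : SoloInformedLogRoomAt k m) (hB : IsSemialgebraic ℚ B)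
    (hξ : ∀ i, IsSemialgebraicFunOn ℚ B (ξ i)) (d₀ : SoloInformedLRData B (bandOver B ξ j) F)
    (hS : SoloInformedSideHyp B p σ d₀.a HW H₀ (soloInformedBandI d₀) Λ CW C₂ c)
    (hj0 : j = 0) (hjl : j ≠ Fin.last l) (t : Fin k → ℝ)
    (hfin : ∫⁻ x, H₀ (Fin.append t x) < ∞) : ∫⁻ x, B.indicator HW (Fin.append t x) < ∞ := by
  subst hj0
  have hα : IsSemialgebraicFunOn ℚ B (fun w => d₀.θ w - (bandUpper ξ 0 w).toReal) :=
    (IsSemialgebraicFunOn.sub_holds d₀.θ_sa (soloInformed_sa_bandUpper_toReal hB hξ 0)).congr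
      fun _ _ => rfl
  refine soloInformed_side_top_lt_top ih hS hα d₀.r (fun w hw => ?_) t hfin
  have hu : bandUpper ξ 0 w = ((ξ (Fin.castPred 0 hjl) w : ℝ) : EReal) :=
    bandUpper_of_ne_last ξ 0 hjl w
  have hlu : bandLower ξ 0 w < bandUpper ξ 0 w := by
    rw [bandLower_zero, hu]; exact EReal.bot_lt_coe _
  rcases soloInformed_band_I_normalised d₀ hw hlu with ⟨h, -⟩ | ⟨huθ, hI⟩
  · exfalso
    rw [bandLower_zero, le_bot_iff] at h
    exact EReal.coe_ne_bot _ h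
  · refine ⟨(soloInformed_normalised_below huθ hlu).1, ?_⟩
    change soloInformedBandI d₀ w = _ at hI
    rw [show ((d₀.θ w : ℝ) : EReal) - bandLower ξ 0 w = ⊤ by
      rw [bandLower_zero, EReal.coe_sub_bot]] at hI
    exact hI

/-- Upper half-line fibres (`j = last ≠ 0`): every centre lies below, `β = ⊤`. -/
theorem soloInformed_band_sides_upper (ih : SoloInformedLogRoomAt k m) (hB : IsSemialgebraic ℚ B)
    (hξ : ∀ i, IsSemialgebraicFunOn ℚ B (ξ i)) (d₀ : SoloInformedLRData B (bandOver B ξ j) F)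
    (hS : SoloInformedSideHyp B p σ d₀.a HW H₀ (soloInformedBandI d₀) Λ CW C₂ c)
    (hj0 : j ≠ 0) (hjl : j = Fin.last l) (t : Fin k → ℝ)
    (hfin : ∫⁻ x, H₀ (Fin.append t x) < ∞) : ∫⁻ x, B.indicator HW (Fin.append t x) < ∞ := by
  subst hjl
  have hα : IsSemialgebraicFunOn ℚ B (fun w => (bandLower ξ (Fin.last l) w).toReal - d₀.θ w) :=
    (IsSemialgebraicFunOn.sub_holds (soloInformed_sa_bandLower_toReal hB hξ _) d₀.θ_sa).congr
      fun _ _ => rfl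
  refine soloInformed_side_top_lt_top ih hS hα d₀.r (fun w hw => ?_) t hfin
  have hl : bandLower ξ (Fin.last l) w = ((ξ (Fin.pred (Fin.last l) hj0) w : ℝ) : EReal) :=
    bandLower_of_ne_zero ξ _ hj0 w
  have hlu : bandLower ξ (Fin.last l) w < bandUpper ξ (Fin.last l) w := by
    rw [bandUpper_last, hl]; exact EReal.coe_lt_top _
  rcases soloInformed_band_I_normalised d₀ hw hlu with ⟨hθl, hI⟩ | ⟨h, -⟩
  · refine ⟨(soloInformed_normalised_above hθl hlu).1, ?_⟩
    change soloInformedBandI d₀ w = _ at hI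
    rw [show bandUpper ξ (Fin.last l) w - ((d₀.θ w : ℝ) : EReal) = ⊤ by
      rw [bandUpper_last, EReal.top_sub_coe]] at hI
    exact hI
  · exfalso
    rw [bandUpper_last, top_le_iff] at h
    exact EReal.coe_ne_top _ h

/-- Bounded fibres (`0 ≠ j ≠ last`): the base splits into the two sides `{θ ≤ l}` and `{u ≤ θ}`,
each handled by the bounded-fibre case analysis. -/
theorem soloInformed_band_sides_middle (ih : SoloInformedLogRoomAt k m) (hB : IsSemialgebraic ℚ B)
    (hξ : ∀ i, IsSemialgebraicFunOn ℚ B (ξ i)) (d₀ : SoloInformedLRData B (bandOver B ξ j) F)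
    (hS : SoloInformedSideHyp B p σ d₀.a HW H₀ (soloInformedBandI d₀) Λ CW C₂ c)
    (hempty : ∀ w ∈ B, ¬ bandLower ξ j w < bandUpper ξ j w → HW w = 0)
    (hj0 : j ≠ 0) (hjl : j ≠ Fin.last l) (t : Fin k → ℝ)
    (hfin : ∫⁻ x, H₀ (Fin.append t x) < ∞) : ∫⁻ x, B.indicator HW (Fin.append t x) < ∞ := by
  have hlo := soloInformed_sa_bandLower_toReal hB hξ j
  have hup := soloInformed_sa_bandUpper_toReal hB hξ j
  have hl : ∀ w, bandLower ξ j w = ((ξ (j.pred hj0) w : ℝ) : EReal) := bandLower_of_ne_zero ξ j hj0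
  have hu : ∀ w, bandUpper ξ j w = ((ξ (j.castPred hjl) w : ℝ) : EReal) :=
    bandUpper_of_ne_last ξ j hjl
  -- the two sides
  have hplus : IsSemialgebraic ℚ {w | w ∈ B ∧ 0 ≤ ((fun w => (bandLower ξ j w).toReal) - d₀.θ) w} :=
    (IsSemialgebraicFunOn.sub_holds hlo d₀.θ_sa).isSemialgebraic_sep_nonneg
  have hminus : IsSemialgebraic ℚ {w | w ∈ B ∧ 0 ≤ (d₀.θ - fun w => (bandUpper ξ j w).toReal) w} :=
    (IsSemialgebraicFunOn.sub_holds d₀.θ_sa hup).isSemialgebraic_sep_nonneg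
  refine soloInformed_cover_lintegral_lt_top' (B := B)
    (fun bb : Bool => cond bb {w | w ∈ B ∧ 0 ≤ ((fun w => (bandLower ξ j w).toReal) - d₀.θ) w}
      {w | w ∈ B ∧ 0 ≤ (d₀.θ - fun w => (bandUpper ξ j w).toReal) w})
    (soloInformed_measurableSet_cond hplus hminus) hS.meas_HW (fun w hw => Or.inr ?_) t ?_
  · rcases soloInformed_EIoo_side (d₀.θ_notMem hw) with h | h
    · refine ⟨true, hw, ?_⟩
      show 0 ≤ (bandLower ξ j w).toReal - d₀.θ w
      rw [hl w, EReal.toReal_coe]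
      rw [hl w, EReal.coe_le_coe_iff] at h
      linarith
    · refine ⟨false, hw, ?_⟩
      show 0 ≤ d₀.θ w - (bandUpper ξ j w).toReal
      rw [hu w, EReal.toReal_coe]
      rw [hu w, EReal.coe_le_coe_iff] at h
      linarith
  · rintro (_ | _)
    · -- the side `u ≤ θ`: `α = θ − u`, `b = θ − l`
      refine soloInformed_side_fin_lt_top ih (hS.mono (fun w hw => hw.1) hminus)
        (α := fun w => d₀.θ w - (bandUpper ξ j w).toReal)
        (b := fun w => d₀.θ w - (bandLower ξ j w).toReal)
        (((IsSemialgebraicFunOn.sub_holds d₀.θ_sa hup).mono (fun w hw => hw.1) hminus).congr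
          fun _ _ => rfl)
        (((IsSemialgebraicFunOn.sub_holds d₀.θ_sa hlo).mono (fun w hw => hw.1) hminus).congr
          fun _ _ => rfl)
        d₀.r (fun w hw => ?_) t hfin
      obtain ⟨hwB, hw0⟩ := hw
      have hw0' : 0 ≤ d₀.θ w - (bandUpper ξ j w).toReal := hw0
      rw [hu w, EReal.toReal_coe] at hw0'
      refine ⟨by rw [hu w, EReal.toReal_coe]; exact hw0', fun hab => ?_, fun hba => ?_⟩
      · rw [hu w, hl w, EReal.toReal_coe, EReal.toReal_coe] at hab ⊢
        have hlu : bandLower ξ j w < bandUpper ξ j w := by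
          rw [hl w, hu w, EReal.coe_lt_coe_iff]; linarith
        rcases soloInformed_band_I_normalised d₀ hwB hlu with ⟨h, -⟩ | ⟨-, hI⟩
        · exfalso
          rw [hl w, EReal.coe_le_coe_iff] at h
          linarith
        · change soloInformedBandI d₀ w = _ at hI
          rw [hu w, hl w, EReal.toReal_coe, ← EReal.coe_sub] at hI
          exact hI
      · refine hempty w hwB fun hlu => ?_
        rw [hl w, hu w, EReal.coe_lt_coe_iff] at hlu
        rw [hl w, hu w, EReal.toReal_coe, EReal.toReal_coe] at hba
        linarith
    · -- the side `θ ≤ l`: `α = l − θ`, `b = u − θ`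
      refine soloInformed_side_fin_lt_top ih (hS.mono (fun w hw => hw.1) hplus)
        (α := fun w => (bandLower ξ j w).toReal - d₀.θ w)
        (b := fun w => (bandUpper ξ j w).toReal - d₀.θ w)
        (((IsSemialgebraicFunOn.sub_holds hlo d₀.θ_sa).mono (fun w hw => hw.1) hplus).congr
          fun _ _ => rfl)
        (((IsSemialgebraicFunOn.sub_holds hup d₀.θ_sa).mono (fun w hw => hw.1) hplus).congr
          fun _ _ => rfl)
        d₀.r (fun w hw => ?_) t hfin
      obtain ⟨hwB, hw0⟩ := hw
      have hw0' : 0 ≤ (bandLower ξ j w).toReal - d₀.θ w := hw0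
      rw [hl w, EReal.toReal_coe] at hw0'
      refine ⟨by rw [hl w, EReal.toReal_coe]; exact hw0', fun hab => ?_, fun hba => ?_⟩
      · rw [hu w, hl w, EReal.toReal_coe, EReal.toReal_coe] at hab ⊢
        have hlu : bandLower ξ j w < bandUpper ξ j w := by
          rw [hl w, hu w, EReal.coe_lt_coe_iff]; linarith
        rcases soloInformed_band_I_normalised d₀ hwB hlu with ⟨-, hI⟩ | ⟨h, -⟩
        · change soloInformedBandI d₀ w = _ at hI
          rw [hu w, hl w, EReal.toReal_coe, ← EReal.coe_sub] at hI
          exact hI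
        · exfalso
          rw [hu w, EReal.coe_le_coe_iff] at h
          linarith
      · refine hempty w hwB fun hlu => ?_
        rw [hl w, hu w, EReal.coe_lt_coe_iff] at hlu
        rw [hl w, hu w, EReal.toReal_coe, EReal.toReal_coe] at hba
        linarith

/-- **The sides of a prepared band**: from the bundle over the base, `∫ B.indicator HW < ∞`. -/
theorem soloInformed_band_sides (ih : SoloInformedLogRoomAt k m) (hB : IsSemialgebraic ℚ B)
    (hξ : ∀ i, IsSemialgebraicFunOn ℚ B (ξ i)) (d₀ : SoloInformedLRData B (bandOver B ξ j) F)
    (hS : SoloInformedSideHyp B p σ d₀.a HW H₀ (soloInformedBandI d₀) Λ CW C₂ c)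
    (hempty : ∀ w ∈ B, ¬ bandLower ξ j w < bandUpper ξ j w → HW w = 0) (t : Fin k → ℝ)
    (hfin : ∫⁻ x, H₀ (Fin.append t x) < ∞) : ∫⁻ x, B.indicator HW (Fin.append t x) < ∞ := by
  by_cases hj0 : j = 0
  · by_cases hjl : j = Fin.last l
    · exact soloInformed_band_sides_line d₀ hj0 hjl t
    · exact soloInformed_band_sides_lower ih hB hξ d₀ hS hj0 hjl t hfin
  · by_cases hjl : j = Fin.last l
    · exact soloInformed_band_sides_upper ih hB hξ d₀ hS hj0 hjl t hfin
    · exact soloInformed_band_sides_middle ih hB hξ d₀ hS hempty hj0 hjl t hfin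

/-- **Finiteness of the weighted integral over a prepared band.**  If `F`, `ρᵢ` carry Lion–Rolin
data over the base `B` of the band `D = bandOver B ξ j`, the integrands `H`, `H₀` agree on `D` with
`F (1 + Σᵢ |log ρᵢ|)ᵖ` and `|F|`, and `∫ D.indicator H₀ (t, ·) < ∞`, then
`∫ D.indicator H (t, ·) < ∞` — granted `SoloInformedLogRoomAt k m`. -/
theorem soloInformed_band_lt_top (ih : SoloInformedLogRoomAt k m) (hB : IsSemialgebraic ℚ B)
    (hξ : ∀ i, IsSemialgebraicFunOn ℚ B (ξ i)) (j : Fin (l + 1)) (p : ℕ)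
    {ρ : ι → (Fin (k + m + 1) → ℝ) → ℝ} (d₀ : SoloInformedLRData B (bandOver B ξ j) F)
    (d : ∀ i, SoloInformedLRData B (bandOver B ξ j) (ρ i))
    {H H₀ : (Fin (k + m + 1) → ℝ) → ℝ≥0∞} (hHm : Measurable H) (hH₀m : Measurable H₀)
    (hH : ∀ z ∈ bandOver B ξ j, H z = ENNReal.ofReal (F z * (1 + ∑ i, |Real.log (ρ i z)|) ^ p))
    (hH₀ : ∀ z ∈ bandOver B ξ j, H₀ z = ENNReal.ofReal |F z|) (t : Fin k → ℝ)
    (hfin : ∫⁻ x : Fin (m + 1) → ℝ,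
      (bandOver B ξ j).indicator H₀ (Fin.append t x : Fin (k + (m + 1)) → ℝ) < ∞) :
    ∫⁻ x : Fin (m + 1) → ℝ,
      (bandOver B ξ j).indicator H (Fin.append t x : Fin (k + (m + 1)) → ℝ) < ∞ := by
  have hD : MeasurableSet (bandOver B ξ j) :=
    (soloInformed_isSemialgebraic_bandOver hB hξ j).measurableSet_holds
  rw [soloInformed_lintegral_band_append hD hHm t, soloInformed_bandHW_eq_indicator H]
  rw [soloInformed_lintegral_band_append hD hH₀m t] at hfin
  obtain ⟨C, -, hS⟩ := soloInformed_band_sideHyp hB hξ p d₀ d hHm hH₀m hH hH₀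
  refine soloInformed_band_sides ih hB hξ d₀ hS (fun w hw hlu => ?_) t hfin
  rw [soloInformed_bandHW_congr hH hw, soloInformed_EIoo_eq_empty hlu]
  simp

end Summit.KontsevichZagierPeriods.KontsevichZagierPeriods.Theorems
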